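import Mathlib
import Literature.NumberTheory.LFunctions.Zhang2022.Section6Statements
import Literature.NumberTheory.LFunctions.Zhang2022.Section6LFunctionStripGrowth
import Literature.NumberTheory.LFunctions.Zhang2022.Section6SegmentSplit
import Literature.Analysis.Complex.VerticalLineShiftPoles
import HarnessLib

/-!
# Zhang (2022) §6, proof of Lemma 6.1: the contour shift "moving the line of integration to
# `u = −1`" (DAG node `Z22:§6.u008`), DISCHARGED

Topic `Literature/NumberTheory/LFunctions/Zhang2022` (Landau–Siegel audit tree; verdict-neutral).
Y. Zhang, *Discrete mean estimates and the Landau–Siegel zero*, arXiv:2211.02515v1 (2022)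
[Zhang2022LandauSiegel] — **an unrefereed manuscript under adjudication; nothing here asserts or
denies its Theorems 1–2.** Campaign D-0069, discharge lane (seat sz-d26), node `Z22:§6.u008`
[Z22 p.31, tex L1711], typed statement-exact by L2-t1 as `Section6Statements.Step6u008`
(`Section6Statements.lean`, v2 with the blanket Assumption (A) antecedent):

> By (4.3) we have `(1/2πi)∫_{(1)} L(s+w,ψ)P₄^w ω₁(w)dw/w = K(s,ψ) + O(ε)`. **The left side above
> is, by moving the line of integration to `u = −1`, equal to
> `L(s,ψ) + (1/2πi)∫_{(−1)} L(s+w,ψ)P₄^w ω₁(w)dw/w`.**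

This file PROVES that sentence as typed (`step6u008_holds : Section6Statements.Step6u008`), and
in fact the underlying identity for EVERY `s ∈ ℂ`, every modulus `D ≥ 2` and every `ψ (mod p) ∈ Ψ`
(`vline_integrandL_one_eq`) — neither the standing range of Lemma 6.1 nor (A) is needed for this
step. The mechanism is the tree's residue theorem for vertical lines
(`Literature.Analysis.Complex.integral_vertical_sub_eq_sum_of_poles`): the integrand
`F(w) = L(s+w,ψ)P₄^w ω₁(w)/w` is meromorphic in `w` with a single simple pole at `w = 0`
(`L(·,ψ)` is entire for the non-principal `ψ`), residue `L(s,ψ)P₄⁰ω₁(0) = L(s,ψ)`; it is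
integrable along every line `Re w = u`, `0 < |u| ≤ 1` (`integrable_integrandL_line`, reusable by
the (6.1)–(6.3) dischargers) and uniformly small on the horizontal segments `[−1,1] × {±T}`,
because `|ω₁(u+iv)| = e^{(u²−v²)/4𝓛³⁰}` (tree `GaussWeight.norm_omega1`) decays like a Gaussian
while `L(s+w,ψ)` grows at most polynomially in `|Im w|` for `Re w ∈ [−1,1]` — the tree's
`StripGrowth.exists_norm_LFunction_le_pow` (MV Cor. 10.10: functional equation + Stirling; this is
where `Re(s+w) ≈ −1/2`, left of the critical strip, enters).

| decl | content |
|---|---|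
| `exists_norm_integrandL_le` | `‖F(u+iv)‖ ≤ K(1+|v|)ᴺe^{−bv²}` on `|u| ≤ 1`, `|u+iv| ≥ 1`, with `(1+|v|)ᴺe^{−bv²}` integrable |
| `integrable_integrandL_line` | `v ↦ F(u+iv)` is integrable for `0 < |u| ≤ 1` |
| `vline_integrandL_one_eq` | `D ≥ 2`, `x : Chr D`, any `s`: `vline F 1 = L(s,ψ) + vline F (−1)` |
| `step6u008_holds` | **`Section6Statements.Step6u008` holds** (node `Z22:§6.u008` discharged) |

WHAT THIS IS NOT: a discharge of (6.1)–(6.3) or of Lemma 6.1, or any claim about Theorems 1–2 /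
Landau–Siegel zeros; one proof-internal display of §6, kernel-checked.

## References

* Y. Zhang, arXiv:2211.02515v1 (2022), §6 p. 31 (proof of Lemma 6.1, tex L1706–1714); §4 p. 18
  (`ω₁`). [cite: Zhang2022LandauSiegel, §6 p.31]
* H. L. Montgomery, R. C. Vaughan, *Multiplicative Number Theory I*, CUP 2007, §10.1 Cor. 10.10.
  [cite: MontgomeryVaughan2007, §10.1 Cor. 10.10]
-/

noncomputable section

open Complex Real MeasureTheory Filter Set
open scoped Topology

namespace Literature.NumberTheory.LFunctions.Zhang2022.Section6Shift

open Skeleton Section6Statements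

/-! ### §1. Plumbing: a Gaussian moment is integrable -/

/-- `(1 + |v|)ᴺ e^{−bv²}` is integrable on `ℝ` for `b > 0` (from Mathlib's
`integrable_rpow_mul_exp_neg_mul_sq` and `(1+a)ᴺ ≤ 2ᴺ(1+aᴺ)`). [folklore] -/
private theorem integrable_one_add_abs_pow_mul_exp_neg_mul_sq {b : ℝ} (hb : 0 < b) (N : ℕ) :
    Integrable fun v : ℝ => (1 + |v|) ^ N * Real.exp (-b * v ^ 2) := by
  have h0 : Integrable fun v : ℝ => Real.exp (-b * v ^ 2) := integrable_exp_neg_mul_sq hb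
  have hN : Integrable fun v : ℝ => v ^ (N : ℝ) * Real.exp (-b * v ^ 2) :=
    integrable_rpow_mul_exp_neg_mul_sq hb (by linarith [N.cast_nonneg (α := ℝ)])
  have hN' : Integrable fun v : ℝ => |v| ^ N * Real.exp (-b * v ^ 2) := by
    refine hN.norm.congr (ae_of_all _ fun v => ?_)
    simp only [norm_mul, Real.norm_eq_abs, Real.rpow_natCast, abs_pow, Real.abs_exp]
  have hsum := (h0.add hN').const_mul ((2 : ℝ) ^ N)
  refine hsum.mono' ?_ (ae_of_all _ fun v => ?_)
  · have hc : Continuous fun v : ℝ => (1 + |v|) ^ N * Real.exp (-b * v ^ 2) := by fun_prop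
    exact hc.aestronglyMeasurable
  · rw [Real.norm_of_nonneg (by positivity)]
    have key : (1 + |v|) ^ N ≤ 2 ^ N * (1 + |v| ^ N) := by
      have ha : 0 ≤ |v| := abs_nonneg v
      have hvN : 0 ≤ |v| ^ N := by positivity
      rcases le_or_gt |v| 1 with h | h
      · calc (1 + |v|) ^ N ≤ 2 ^ N := pow_le_pow_left₀ (by positivity) (by linarith) N
          _ = 2 ^ N * 1 := (mul_one _).symm
          _ ≤ 2 ^ N * (1 + |v| ^ N) := by gcongr; linarith
      · calc (1 + |v|) ^ N ≤ (2 * |v|) ^ N := pow_le_pow_left₀ (by positivity) (by linarith) N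
          _ = 2 ^ N * |v| ^ N := mul_pow _ _ _
          _ ≤ 2 ^ N * (1 + |v| ^ N) := by gcongr; linarith
    calc (1 + |v|) ^ N * Real.exp (-b * v ^ 2)
        ≤ 2 ^ N * (1 + |v| ^ N) * Real.exp (-b * v ^ 2) := by gcongr
      _ = 2 ^ N * (Real.exp (-b * v ^ 2) + |v| ^ N * Real.exp (-b * v ^ 2)) := by ring

/-! ### §2. The integrand `F(w) = L(s+w,ψ)P₄^w ω₁(w)/w` on the strip `|Re w| ≤ 1` -/

variable {D : ℕ}

/- `P4_pos` (`0 < P4 D` for `2 ≤ D`) was re-proved here; it is the already-landed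
`Section6Statements.P4_pos` of `Section6SegmentSplit` (imported above, 2026-08-28 — dedup.landed hygiene). -/

/-- **A Gaussian majorant for the §6 integrand on the closed strip.** For `D ≥ 2`, `ψ (mod p) ∈ Ψ`
and any `s`, there are `K, b > 0` and `N ∈ ℕ` with `‖L(s+w,ψ)P₄^w ω₁(w)/w‖·|w| ≤ K(1+|v|)ᴺe^{−bv²}`
for all `w = u + iv` with `|u| ≤ 1`, and `(1+|v|)ᴺe^{−bv²}` integrable — from the polynomial growth
of `L(s+w,ψ)` (`StripGrowth.exists_norm_LFunction_le_pow`, MV Cor. 10.10), `|P₄^w| = P₄^u ≤ e^{|log P₄|}`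
and `|ω₁(u+iv)| = e^{(u²−v²)/4𝓛³⁰}` (`b = 1/4𝓛³⁰`). [cite: Zhang2022LandauSiegel, §6 p.31] -/
theorem exists_norm_integrandL_mul_le (hD : 2 ≤ D) (x : Chr D) (s : ℂ) :
    ∃ K b : ℝ, ∃ N : ℕ, 0 < K ∧ 0 < b ∧
      (∀ u : ℝ, |u| ≤ 1 → ∀ v : ℝ,
        ‖integrandL x s ((u : ℂ) + (v : ℂ) * I)‖ * ‖(u : ℂ) + (v : ℂ) * I‖ ≤
          K * ((1 + |v|) ^ N * Real.exp (-b * v ^ 2))) ∧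
      Integrable fun v : ℝ => K * ((1 + |v|) ^ N * Real.exp (-b * v ^ 2)) := by
  have hℓ : 0 < ell D := Real.log_pos (by exact_mod_cast hD)
  set Λ : ℝ := ell D ^ 30 with hΛ
  have hΛ0 : 0 < Λ := pow_pos hℓ 30
  have hP0 : 0 < P4 D := Section6Statements.P4_pos hD
  -- polynomial growth of `L(s+w,ψ)` on `|Re w| ≤ 1`
  set A : ℕ := ⌈|s.re|⌉₊ + 1 with hAdef
  have hA1 : 1 ≤ A := by omega
  obtain ⟨C, hC0, hC⟩ :=
    StripGrowth.exists_norm_LFunction_le_pow (θ := x.ψ) x.prim x.p_ne_one hA1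
  set N : ℕ := A + 2 with hNdef
  set b : ℝ := 1 / (4 * Λ) with hbdef
  have hb0 : 0 < b := by rw [hbdef]; positivity
  set K : ℝ := C * (|s.im| + A + 1) ^ N * Real.exp (|Real.log (P4 D)|) * Real.exp (1 / (4 * Λ))
    with hKdef
  have hK0 : 0 < K := by rw [hKdef]; positivity
  refine ⟨K, b, N, hK0, hb0, fun u hu v => ?_,
    (integrable_one_add_abs_pow_mul_exp_neg_mul_sq hb0 N).const_mul K⟩
  set w : ℂ := (u : ℂ) + (v : ℂ) * I with hwdef
  -- `L`
  have hre : |(s + w).re| ≤ A := by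
    have h1 : (s + w).re = s.re + u := by simp [hwdef]
    rw [h1]
    have h2 : |s.re| ≤ ⌈|s.re|⌉₊ := Nat.le_ceil _
    have h3 : (A : ℝ) = ⌈|s.re|⌉₊ + 1 := by rw [hAdef]; push_cast; ring
    rw [h3]
    calc |s.re + u| ≤ |s.re| + |u| := abs_add_le _ _
      _ ≤ ⌈|s.re|⌉₊ + 1 := add_le_add h2 hu
  have hLb := hC (s + w) hre
  have him : (s + w).im = s.im + v := by simp [hwdef]
  rw [him] at hLb
  have hA0 : (0 : ℝ) ≤ A := Nat.cast_nonneg A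
  have hpoly : (|s.im + v| + A + 1) ^ N ≤ (|s.im| + A + 1) ^ N * (1 + |v|) ^ N := by
    rw [← mul_pow]
    apply pow_le_pow_left₀ (by positivity)
    have h1 : |s.im + v| ≤ |s.im| + |v| := abs_add_le _ _
    have h2 : 0 ≤ |v| := abs_nonneg v
    nlinarith [abs_nonneg s.im]
  have hLb' : ‖x.ψ.LFunction (s + w)‖ ≤ C * (|s.im| + A + 1) ^ N * (1 + |v|) ^ N := by
    calc ‖x.ψ.LFunction (s + w)‖ ≤ C * (|s.im + v| + A + 1) ^ N := hLb
      _ ≤ C * ((|s.im| + A + 1) ^ N * (1 + |v|) ^ N) := by gcongr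
      _ = _ := by ring
  -- `P₄^w`
  have hPb : ‖((P4 D : ℝ) : ℂ) ^ w‖ ≤ Real.exp (|Real.log (P4 D)|) := by
    rw [Complex.norm_cpow_eq_rpow_re_of_pos hP0]
    have h1 : w.re = u := by simp [hwdef]
    rw [h1, Real.rpow_def_of_pos hP0]
    apply Real.exp_le_exp.mpr
    calc Real.log (P4 D) * u ≤ |Real.log (P4 D) * u| := le_abs_self _
      _ = |Real.log (P4 D)| * |u| := abs_mul _ _
      _ ≤ |Real.log (P4 D)| * 1 := by gcongr
      _ = |Real.log (P4 D)| := mul_one _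
  -- `ω₁`
  have hωb : ‖GaussWeight.omega1 Λ w‖ ≤ Real.exp (1 / (4 * Λ)) * Real.exp (-b * v ^ 2) := by
    rw [hwdef, GaussWeight.norm_omega1, ← Real.exp_add]
    apply Real.exp_le_exp.mpr
    rw [hbdef, sub_div]
    have h1 : u ^ 2 / (4 * Λ) ≤ 1 / (4 * Λ) := by
      apply div_le_div_of_nonneg_right _ (by positivity)
      have := (abs_le.1 hu).1; have := (abs_le.1 hu).2; nlinarith
    have h2 : -(1 / (4 * Λ)) * v ^ 2 = -(v ^ 2 / (4 * Λ)) := by ring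
    rw [h2]
    linarith
  -- assemble
  have hnum : ‖x.ψ.LFunction (s + w) * (((P4 D : ℝ) : ℂ) ^ w * GaussWeight.omega1 Λ w)‖ ≤
      K * ((1 + |v|) ^ N * Real.exp (-b * v ^ 2)) := by
    calc ‖x.ψ.LFunction (s + w) * (((P4 D : ℝ) : ℂ) ^ w * GaussWeight.omega1 Λ w)‖
        = ‖x.ψ.LFunction (s + w)‖ * (‖((P4 D : ℝ) : ℂ) ^ w‖ * ‖GaussWeight.omega1 Λ w‖) := by
          simp only [norm_mul]
      _ ≤ (C * (|s.im| + A + 1) ^ N * (1 + |v|) ^ N) *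
            (Real.exp (|Real.log (P4 D)|) * (Real.exp (1 / (4 * Λ)) * Real.exp (-b * v ^ 2))) := by
          gcongr
      _ = K * ((1 + |v|) ^ N * Real.exp (-b * v ^ 2)) := by rw [hKdef]; ring
  have hF : integrandL x s w =
      x.ψ.LFunction (s + w) * (((P4 D : ℝ) : ℂ) ^ w * GaussWeight.omega1 Λ w) / w := by
    rw [integrandL, kern, hΛ]; ring
  rw [hF, norm_div]
  rcases eq_or_ne w 0 with h0 | h0
  · rw [h0, norm_zero, mul_zero]
    positivity
  · rw [div_mul_cancel₀ _ (norm_ne_zero_iff.mpr h0)]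
    exact hnum

/-- The §6 integrand is continuous along every vertical line `Re w = u ≠ 0` (`L(·,ψ)` entire for the
non-principal `ψ`; `P₄^w`, `ω₁` entire; `1/w` off `0`). [cite: Zhang2022LandauSiegel, §6 p.31] -/
theorem continuous_integrandL_line (hD : 2 ≤ D) (x : Chr D) (s : ℂ) {u : ℝ} (hu0 : u ≠ 0) :
    Continuous fun v : ℝ => integrandL x s ((u : ℂ) + (v : ℂ) * I) := by
  have hP0 : 0 < P4 D := Section6Statements.P4_pos hD
  have hPne : ((P4 D : ℝ) : ℂ) ≠ 0 := ofReal_ne_zero.mpr hP0.ne'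
  have hne : ∀ v : ℝ, (u : ℂ) + (v : ℂ) * I ≠ 0 := by
    intro v h
    have := congrArg Complex.re h
    simp at this
    exact hu0 this
  have hL : Continuous fun w : ℂ => x.ψ.LFunction (s + w) :=
    ((DirichletCharacter.differentiable_LFunction x.ψ_ne_one).comp
      (differentiable_id.const_add s)).continuous
  have hPd : Continuous fun w : ℂ => ((P4 D : ℝ) : ℂ) ^ w :=
    (differentiable_id.const_cpow (Or.inl hPne)).continuous
  have hω : Continuous (GaussWeight.omega1 (ell D ^ 30)) := by
    unfold GaussWeight.omega1; fun_prop
  have hline : Continuous fun v : ℝ => (u : ℂ) + (v : ℂ) * I := by fun_prop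
  have h : Continuous fun v : ℝ => x.ψ.LFunction (s + ((u : ℂ) + (v : ℂ) * I)) *
      (((P4 D : ℝ) : ℂ) ^ ((u : ℂ) + (v : ℂ) * I) * GaussWeight.omega1 (ell D ^ 30)
        ((u : ℂ) + (v : ℂ) * I) / ((u : ℂ) + (v : ℂ) * I)) :=
    (hL.comp hline).mul (((hPd.comp hline).mul (hω.comp hline)).div hline hne)
  refine h.congr fun v => ?_
  rw [integrandL, kern]

/-- **Absolute convergence of `∫_{(u)} L(s+w,ψ)P₄^w ω₁(w)dw/w` for `0 < |u| ≤ 1`** (in particular on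
the two lines `u = ±1` of the proof of Lemma 6.1): `v ↦ F(u+iv)` is integrable on `ℝ`, for `D ≥ 2`,
`ψ ∈ Ψ` and any `s`. [cite: Zhang2022LandauSiegel, §6 p.31] -/
theorem integrable_integrandL_line (hD : 2 ≤ D) (x : Chr D) (s : ℂ) {u : ℝ} (hu0 : u ≠ 0)
    (hu1 : |u| ≤ 1) : Integrable fun v : ℝ => integrandL x s ((u : ℂ) + (v : ℂ) * I) := by
  obtain ⟨K, b, N, hK0, hb0, hFb, hg⟩ := exists_norm_integrandL_mul_le hD x s
  have hu' : 0 < |u| := abs_pos.mpr hu0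
  refine (hg.const_mul |u|⁻¹).mono'
    (continuous_integrandL_line hD x s hu0).aestronglyMeasurable (ae_of_all _ fun v => ?_)
  have hw : |u| ≤ ‖(u : ℂ) + (v : ℂ) * I‖ := by
    calc |u| = |((u : ℂ) + (v : ℂ) * I).re| := by simp
      _ ≤ ‖(u : ℂ) + (v : ℂ) * I‖ := Complex.abs_re_le_norm _
  have hwpos : 0 < ‖(u : ℂ) + (v : ℂ) * I‖ := lt_of_lt_of_le hu' hw
  have h1 := hFb u hu1 v
  rw [← le_div_iff₀ hwpos] at h1
  calc ‖integrandL x s ((u : ℂ) + (v : ℂ) * I)‖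
      ≤ K * ((1 + |v|) ^ N * Real.exp (-b * v ^ 2)) / ‖(u : ℂ) + (v : ℂ) * I‖ := h1
    _ ≤ K * ((1 + |v|) ^ N * Real.exp (-b * v ^ 2)) / |u| :=
        div_le_div_of_nonneg_left (by positivity) hu' hw
    _ = |u|⁻¹ * (K * ((1 + |v|) ^ N * Real.exp (-b * v ^ 2))) := by ring

/-! ### §3. The contour shift -/

/-- **`Z22:§6.u008`, the identity for every `s`.** For `D ≥ 2`, `ψ (mod p) ∈ Ψ` and any `s ∈ ℂ`:
`(1/2πi)∫_{(1)} L(s+w,ψ)P₄^w ω₁(w)dw/w = L(s,ψ) + (1/2πi)∫_{(−1)} L(s+w,ψ)P₄^w ω₁(w)dw/w`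
("moving the line of integration to `u = −1`": the only singularity crossed is the simple pole of
`1/w` at `w = 0`, with residue `L(s,ψ)P₄⁰ω₁(0) = L(s,ψ)`; both line integrals converge absolutely and
the horizontal sides vanish in the limit by the Gaussian decay of `ω₁` against the polynomial growth
of `L(s+w,ψ)`, MV Cor. 10.10). [cite: Zhang2022LandauSiegel, §6 p.31] -/
theorem vline_integrandL_one_eq (hD : 2 ≤ D) (x : Chr D) (s : ℂ) :
    vline (integrandL x s) 1 = x.ψ.LFunction s + vline (integrandL x s) (-1) := by
  -- parameters
  have hℓ : 0 < ell D := Real.log_pos (by exact_mod_cast hD)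
  set Λ : ℝ := ell D ^ 30 with hΛ
  have hP0 : 0 < P4 D := Section6Statements.P4_pos hD
  have hPne : ((P4 D : ℝ) : ℂ) ≠ 0 := ofReal_ne_zero.mpr hP0.ne'
  have hψ : x.ψ ≠ 1 := x.ψ_ne_one
  -- the numerator `φ(w) = L(s+w,ψ)P₄^w ω₁(w)` and the integrand `F = φ/w`
  set φ : ℂ → ℂ := fun w =>
    x.ψ.LFunction (s + w) * ((((P4 D : ℝ) : ℂ)) ^ w * GaussWeight.omega1 Λ w) with hφdef
  have hF_eq : ∀ w : ℂ, integrandL x s w = φ w / w := by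
    intro w
    simp only [integrandL, kern, hφdef, hΛ]
    ring
  have hL : Differentiable ℂ fun w : ℂ => x.ψ.LFunction (s + w) :=
    (DirichletCharacter.differentiable_LFunction hψ).comp (differentiable_id.const_add s)
  have hPd : Differentiable ℂ fun w : ℂ => ((P4 D : ℝ) : ℂ) ^ w :=
    differentiable_id.const_cpow (Or.inl hPne)
  have hω : Differentiable ℂ (GaussWeight.omega1 Λ) := by
    unfold GaussWeight.omega1; fun_prop
  have hφ : Differentiable ℂ φ := hL.mul (hPd.mul hω)
  -- the Gaussian majorant
  obtain ⟨K, b, N, hK0, hb0, hFb, hg⟩ := exists_norm_integrandL_mul_le hD x s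
  -- uniform decay on the horizontal segments `[−1,1] × {±T}`
  have hdecay : ∀ ε : ℝ, 0 < ε → ∃ T₀ : ℝ, ∀ T : ℝ, T₀ ≤ |T| →
      ∀ u ∈ Icc (-1 : ℝ) 1, ‖integrandL x s ((u : ℂ) + (T : ℂ) * I)‖ ≤ ε := by
    refine Literature.Analysis.Complex.decay_of_bound (T₀ := 1)
      (g := fun T : ℝ => K * (2 ^ N / b ^ N) * ((b * T ^ 2) ^ N * Real.exp (-(b * T ^ 2))))
      (fun T hT u hu => ?_) ?_
    · have hu : |u| ≤ 1 := abs_le.2 ⟨hu.1, hu.2⟩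
      have hw : 1 ≤ ‖(u : ℂ) + (T : ℂ) * I‖ := by
        calc (1 : ℝ) ≤ |T| := hT
          _ = |((u : ℂ) + (T : ℂ) * I).im| := by simp
          _ ≤ ‖(u : ℂ) + (T : ℂ) * I‖ := Complex.abs_im_le_norm _
      have h1 : ‖integrandL x s ((u : ℂ) + (T : ℂ) * I)‖ ≤
          K * ((1 + |T|) ^ N * Real.exp (-b * T ^ 2)) := by
        have h := hFb u hu T
        calc ‖integrandL x s ((u : ℂ) + (T : ℂ) * I)‖
            = ‖integrandL x s ((u : ℂ) + (T : ℂ) * I)‖ * 1 := (mul_one _).symm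
          _ ≤ ‖integrandL x s ((u : ℂ) + (T : ℂ) * I)‖ * ‖(u : ℂ) + (T : ℂ) * I‖ := by
              gcongr
          _ ≤ _ := h
      -- `(1+|T|)^N ≤ 2^N |T|^N ≤ 2^N (T²)^N = (2^N/b^N)(bT²)^N` for `|T| ≥ 1`
      have hTsq : |T| ^ 2 = T ^ 2 := sq_abs T
      have h2 : (1 + |T|) ^ N ≤ 2 ^ N / b ^ N * (b * T ^ 2) ^ N := by
        have hbN : 0 < b ^ N := pow_pos hb0 N
        have e : 2 ^ N / b ^ N * (b * T ^ 2) ^ N = 2 ^ N * (T ^ 2) ^ N := by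
          rw [mul_pow]; field_simp
        rw [e]
        calc (1 + |T|) ^ N ≤ (2 * |T|) ^ N := pow_le_pow_left₀ (by positivity) (by linarith) N
          _ = 2 ^ N * |T| ^ N := mul_pow _ _ _
          _ ≤ 2 ^ N * (T ^ 2) ^ N := by
              gcongr
              calc |T| = |T| ^ 1 := (pow_one _).symm
                _ ≤ |T| ^ 2 := pow_le_pow_right₀ hT (by norm_num)
                _ = T ^ 2 := hTsq
      calc ‖integrandL x s ((u : ℂ) + (T : ℂ) * I)‖
          ≤ K * ((1 + |T|) ^ N * Real.exp (-b * T ^ 2)) := h1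
        _ ≤ K * ((2 ^ N / b ^ N * (b * T ^ 2) ^ N) * Real.exp (-b * T ^ 2)) := by gcongr
        _ = K * (2 ^ N / b ^ N) * ((b * |T| ^ 2) ^ N * Real.exp (-(b * |T| ^ 2))) := by
            rw [hTsq]; ring
    · have h1 : Tendsto (fun T : ℝ => b * T ^ 2) atTop atTop :=
        (tendsto_pow_atTop two_ne_zero).const_mul_atTop hb0
      have h2 := (tendsto_pow_mul_exp_neg_atTop_nhds_zero N).comp h1
      have h3 := h2.const_mul (K * (2 ^ N / b ^ N))
      rw [mul_zero] at h3
      exact h3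
  -- the residue theorem for the two lines
  have hS : ∀ p ∈ ({0} : Finset ℂ), (-1 : ℝ) < p.re ∧ p.re < (1 : ℝ) := by
    intro p hp; rw [Finset.mem_singleton] at hp; subst hp; norm_num
  have hFdiff : DifferentiableOn ℂ (integrandL x s) (Set.univ \ ↑({0} : Finset ℂ)) := by
    have h1 : DifferentiableOn ℂ (fun w => φ w / w) (Set.univ \ ↑({0} : Finset ℂ)) :=
      hφ.differentiableOn.div differentiableOn_id fun w hw => by
        simpa using hw
    exact h1.congr fun w _ => hF_eq w
  have hpole : ∀ p ∈ ({0} : Finset ℂ), ∃ V ∈ 𝓝 p, DifferentiableOn ℂ ((fun _ : ℂ => φ) p) V ∧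
      ∀ z ∈ V, z ≠ p →
        integrandL x s z = (fun _ : ℂ => φ) p z / (z - p) ^ ((fun _ : ℂ => 0) p + 1) := by
    intro p hp
    rw [Finset.mem_singleton] at hp
    subst hp
    refine ⟨Set.univ, univ_mem, hφ.differentiableOn, fun z _ _ => ?_⟩
    simp only [sub_zero, zero_add, pow_one]
    exact hF_eq z
  have hint1 : Integrable fun t : ℝ => integrandL x s (((1 : ℝ) : ℂ) + (t : ℂ) * I) :=
    integrable_integrandL_line hD x s one_ne_zero (by norm_num)
  have hintm1 : Integrable fun t : ℝ => integrandL x s (((-1 : ℝ) : ℂ) + (t : ℂ) * I) :=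
    integrable_integrandL_line hD x s (by norm_num) (by norm_num)
  have key := Literature.Analysis.Complex.integral_vertical_sub_eq_sum_of_poles
    (F := integrandL x s) (show (-1 : ℝ) < 1 by norm_num) ({0} : Finset ℂ) (fun _ => 0)
    (fun _ => φ) Set.univ isOpen_univ (Set.subset_univ _) hS hFdiff hpole hint1 hintm1 hdecay
  -- the residue: `φ(0) = L(s,ψ)`
  have hφ0 : φ 0 = x.ψ.LFunction s := by
    rw [hφdef]
    simp only [add_zero, cpow_zero, one_mul]
    rw [GaussWeight.omega1]
    simp
  simp only [Finset.sum_singleton, iteratedDeriv_zero, Nat.factorial_zero, Nat.cast_one,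
    div_one, hφ0] at key
  -- conclude
  unfold vline
  set I₁ : ℂ := ∫ v : ℝ, integrandL x s (((1 : ℝ) : ℂ) + (v : ℂ) * I) with hI₁
  set I₂ : ℂ := ∫ v : ℝ, integrandL x s (((-1 : ℝ) : ℂ) + (v : ℂ) * I) with hI₂
  have hπ : (π : ℂ) ≠ 0 := ofReal_ne_zero.mpr Real.pi_pos.ne'
  rw [sub_eq_iff_eq_add] at key
  rw [key]
  field_simp

/-- **`Z22:§6.u008` DISCHARGED** [Z22 p.31, tex L1711]. The typed claim
`Section6Statements.Step6u008` — "The left side above is, by moving the line of integration to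
`u = −1`, equal to `L(s,ψ) + (1/2πi)∫_{(−1)} L(s+w,ψ)P₄^w ω₁(w)dw/w`" for `ψ ∈ Ψ` and `s` in the
range of Lemma 6.1, under (A), eventually in `D` — holds (from `vline_integrandL_one_eq`, with
`D₀ = 2`; neither the range hypothesis `InRange61` nor `AssumptionA` is used).
[cite: Zhang2022LandauSiegel, §6 p.31] -/
theorem step6u008_holds : Step6u008 :=
  ⟨2, fun _ _ _ hD _ _ _ x s _ => vline_integrandL_one_eq hD x s⟩

/-- `Step6u008` — `_holds` alias of `step6u008_holds` above under the fact's exact name (appended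
2026-08-28, D-0026 bookkeeping: the proof term is the existing theorem of this file; no statement,
definition or attribute is edited; no new named fact; the ledger's debt table listed the fact
unproved). [cite: Zhang2022LandauSiegel, §6 p.31] -/
theorem _root_.Literature.NumberTheory.LFunctions.Zhang2022.Section6Statements.Step6u008_holds :
    Step6u008 :=
  _root_.Literature.NumberTheory.LFunctions.Zhang2022.Section6Shift.step6u008_holds

end Literature.NumberTheory.LFunctions.Zhang2022.Section6Shift
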